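import Literature.Computability.Complexity.CoinChunks
import Literature.Computability.Complexity.PCPAmplification
import Literature.Computability.Complexity.CountingHierarchyPPoly
import Literature.Computability.QuantumComplexity.PermanentSearchRandom

/-!
# Crux `CubicForrelation.SignedExactCubicForrelationNotPrBPP` (stmt-QuantumAdvantage-13932), line `dual-pingpong-frame`
# (GROW reshape): the GROW machine, X — stages of independent trials (an abstract union bound)

Proof-only support file (`--supports stmt-QuantumAdvantage-13932`) toward the registered stub `stub_growFinder`: the
probabilistic skeleton of the completeness proof, free of the machine. A deterministic STEP `step : σ → chunk → σ` is
applied to the consecutive chunks (length `C`) of a coin string, from `s₀`; states carry an invariant `Inv`, a potential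
`pot` and a terminal flag `term`, with: the step keeps the invariant and either FIXES the state or RAISES the potential;
terminal states are fixed; non-terminal invariant states have potential `< N`; and from every non-terminal invariant state
a uniformly random chunk fixes the state with probability `≤ θ`. Then (`uniformProb_not_term_le`) after `N` STAGES of `T`
chunks each, the final state is non-terminal with probability `≤ N · θ^T`:

* deterministically, a non-terminal final state forces some stage to start non-terminal and make no progress at all —
  every one of its `T` steps fixed the stage's initial state (potential bookkeeping);
* that initial state depends only on the earlier coins, and the `T` chunks of the stage are fresh, so the stage fails
  with probability `≤ θ^T` (product rule `PCPVerifier.uniformProb_blocks`), and the union bound over the `N` stages is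
  `uniformProb_exists_badBlock_le`.

(`uniformProb` bookkeeping reused: `uniformProb_congr`, `uniformProb_mono_of_length'`, `uniformProb_take_of_le`.)

## References

* S. Arora, B. Barak, *Computational Complexity: A Modern Approach*, CUP 2009, §7.4.1 (independent repetitions, union
  bound over fresh coin blocks). [AroraBarak2009]
-/

set_option linter.dupNamespace false -- D-0017: single-problem summit ⇒ `QuantumAdvantage.QuantumAdvantage` by design

namespace Summit.QuantumAdvantage.QuantumAdvantage.Theorems.SignedExactCubicForrelationNotPrBPP.GrowMachine

open Finset Literature.Computability.Complexity
open Literature.Computability.QuantumComplexity (uniformProb_mono_of_length')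

/-! ### Coin-string bookkeeping -/

/-- A chunk of a stage block is a chunk of the whole string: for `t < T`,
`((y ↓ iTC) ↾ TC ↓ tC) ↾ C = (y ↓ (iT + t) C) ↾ C`. [folklore] -/
theorem chunk_of_block (y : List Bool) (C T i t : ℕ) (ht : t < T) :
    ((((y.drop (i * (T * C))).take (T * C)).drop (t * C)).take C) = (y.drop ((i * T + t) * C)).take C := by
  rw [List.drop_take, List.take_take, List.drop_drop, Nat.add_mul, Nat.mul_assoc]
  congr 1
  have : C ≤ T * C - t * C := by
    rw [← Nat.sub_mul]
    exact Nat.le_mul_of_pos_left C (by omega)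
  exact Nat.min_eq_left this

/-- A chunk inside the prefix is a chunk of the prefix: for `(t + 1) C ≤ K`, `(y ↾ K ↓ tC) ↾ C = (y ↓ tC) ↾ C`. [folklore] -/
theorem chunk_of_take (y : List Bool) (C K t : ℕ) (ht : t * C + C ≤ K) :
    (((y.take K).drop (t * C)).take C) = (y.drop (t * C)).take C := by
  rw [List.drop_take, List.take_take, Nat.min_eq_left (by omega)]

/-! ### The abstract union bound over stages -/

section Stages

variable {σ : Type} (step : σ → List Bool → σ) (pot : σ → ℕ) (term : σ → Bool) (Inv : σ → Prop) (C T N : ℕ) (s₀ : σ)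
  (run : ℕ → List Bool → σ) (hrun0 : ∀ y, run 0 y = s₀)
  (hrunS : ∀ k y, run (k + 1) y = step (run k y) ((y.drop (k * C)).take C))
  (h0 : Inv s₀)
  (hstep : ∀ s c, Inv s → Inv (step s c) ∧ (step s c = s ∨ pot s + 1 ≤ pot (step s c)))
  (hterm : ∀ s c, term s = true → step s c = s)
  (hpot : ∀ s, Inv s → term s = false → pot s < N)

include hrun0 hrunS h0 hstep in
/-- Every run state satisfies the invariant, and the potential grows by at least the number of changes. [folklore] -/
theorem inv_run (k : ℕ) (y : List Bool) : Inv (run k y) ∧ pot s₀ ≤ pot (run k y) := by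
  induction k with
  | zero => rw [hrun0]; exact ⟨h0, le_rfl⟩
  | succ k ih =>
    rw [hrunS]
    obtain ⟨hI, hle⟩ := hstep _ ((y.drop (k * C)).take C) ih.1
    refine ⟨hI, ?_⟩
    rcases hle with h | h
    · rw [h]; exact ih.2
    · omega

include hrun0 hrunS h0 hstep in
/-- The potential is monotone along the run. [folklore] -/
theorem pot_run_mono {k k' : ℕ} (hk : k ≤ k') (y : List Bool) : pot (run k y) ≤ pot (run k' y) := by
  induction hk with
  | refl => exact le_rfl
  | step _ ih =>
    rw [hrunS]
    rcases (hstep _ _ (inv_run step pot Inv C s₀ run hrun0 hrunS h0 hstep _ y).1).2 with h | h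
    · rw [h]; exact ih
    · omega

include hrunS hterm in
/-- Terminal states are absorbing. [folklore] -/
theorem run_eq_of_term {k : ℕ} {y : List Bool} (ht : term (run k y) = true) : ∀ k', k ≤ k' → run k' y = run k y := by
  intro k' hk
  induction hk with
  | refl => rfl
  | step _ ih => rw [hrunS, ih, hterm _ _ (ih ▸ ht) ]

include hrun0 hrunS h0 hstep in
/-- **A stage without potential gain fixed its initial state at every step.** [folklore] -/
theorem steps_eq_of_pot_eq {i : ℕ} {y : List Bool} (heq : pot (run ((i + 1) * T) y) = pot (run (i * T) y)) :
    ∀ t, t ≤ T → run (i * T + t) y = run (i * T) y := by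
  intro t ht
  induction t with
  | zero => rfl
  | succ t ih =>
    have ih' := ih (by omega)
    rw [show i * T + (t + 1) = (i * T + t) + 1 by ring, hrunS, ih']
    rcases (hstep _ ((y.drop ((i * T + t) * C)).take C) (inv_run step pot Inv C s₀ run hrun0 hrunS h0 hstep _ y).1).2 with h | h
    · exact h
    · exfalso
      have h1 : pot (run ((i * T + t) + 1) y) ≤ pot (run ((i + 1) * T) y) :=
        pot_run_mono step pot Inv C s₀ run hrun0 hrunS h0 hstep (by rw [Nat.succ_mul]; omega) y
      rw [hrunS, ih'] at h1
      omega

include hrun0 hrunS h0 hstep hterm hpot in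
/-- **A non-terminal final state forces a failed stage**: some stage `i < N` starts in a non-terminal state `s` and every
one of its `T` steps fixes `s`. [folklore] -/
theorem exists_failed_stage {y : List Bool} (hfin : term (run (N * T) y) = false) :
    ∃ i < N, term (run (i * T) y) = false ∧ ∀ t < T, step (run (i * T) y) ((y.drop ((i * T + t) * C)).take C) = run (i * T) y := by
  -- every stage state is non-terminal
  have hnt : ∀ i ≤ N, term (run (i * T) y) = false := by
    intro i hi
    by_contra h
    have ht : term (run (i * T) y) = true := by simpa using h
    have := run_eq_of_term step term C run hrunS hterm ht (N * T) (Nat.mul_le_mul_right T hi)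
    rw [this, ht] at hfin
    exact Bool.noConfusion hfin
  -- some stage gains no potential (otherwise the final potential would be `≥ N`)
  have hex : ∃ i < N, pot (run ((i + 1) * T) y) = pot (run (i * T) y) := by
    by_contra hall
    push Not at hall
    have hgain : ∀ i ≤ N, pot s₀ + i ≤ pot (run (i * T) y) := by
      intro i hi
      induction i with
      | zero => rw [Nat.zero_mul, hrun0, Nat.add_zero]
      | succ i ih =>
        have h1 := ih (by omega)
        have h2 := hall i (by omega)
        have h3 := pot_run_mono step pot Inv C s₀ run hrun0 hrunS h0 hstep (show i * T ≤ (i + 1) * T by nlinarith) y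
        have : pot (run (i * T) y) < pot (run ((i + 1) * T) y) := lt_of_le_of_ne h3 (Ne.symm h2)
        omega
    have hN := hgain N le_rfl
    have hlt := hpot _ (inv_run step pot Inv C s₀ run hrun0 hrunS h0 hstep _ y).1 (hnt N le_rfl)
    omega
  obtain ⟨i, hi, heq⟩ := hex
  refine ⟨i, hi, hnt i hi.le, fun t ht => ?_⟩
  have h1 := steps_eq_of_pot_eq step pot Inv C T s₀ run hrun0 hrunS h0 hstep heq (t + 1) ht
  have h2 := steps_eq_of_pot_eq step pot Inv C T s₀ run hrun0 hrunS h0 hstep heq t ht.le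
  rw [show i * T + (t + 1) = (i * T + t) + 1 by ring, hrunS, h2] at h1
  exact h1

include hrun0 hrunS in
/-- The run up to `k` chunks depends only on the first `k C` coins. [folklore] -/
theorem run_take (k K : ℕ) (hK : k * C ≤ K) (y : List Bool) : run k (y.take K) = run k y := by
  induction k with
  | zero => rw [hrun0, hrun0]
  | succ k ih =>
    rw [hrunS, hrunS, ih (by rw [Nat.succ_mul] at hK; omega), chunk_of_take y C K k (by rw [Nat.succ_mul] at hK; exact hK)]

include hrun0 hrunS h0 hstep hterm hpot in
/-- **The union bound over the stages.** If from every non-terminal invariant state a uniform chunk fixes the state with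
probability `≤ θ` (`0 ≤ θ`), then after `N` stages of `T` chunks the final state is non-terminal with probability
`≤ N · θ^T`. [cite: AroraBarak2009, §7.4.1] -/
theorem uniformProb_not_term_le {θ : ℝ} (hθ : 0 ≤ θ)
    (hprob : ∀ s, Inv s → term s = false → uniformProb C {c | step s c = s} ≤ θ) :
    uniformProb (N * (T * C)) {y | term (run (N * T) y) = false} ≤ N * θ ^ T := by
  set L := T * C with hL
  -- the bad block of stage `i` after the prefix `w`
  set B : ℕ → List Bool → Set (List Bool) := fun i w =>
    {blk | term (run (i * T) w) = false ∧ ∀ t < T, step (run (i * T) w) ((blk.drop (t * C)).take C) = run (i * T) w} with hB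
  have hsub : ∀ y : List Bool, y.length = N * L → term (run (N * T) y) = false →
      ∃ i < N, (y.drop (i * L)).take L ∈ B i (y.take (i * L)) := by
    intro y _ hfin
    obtain ⟨i, hi, hnt, hsteps⟩ := exists_failed_stage step pot term Inv C T N s₀ run hrun0 hrunS h0 hstep hterm hpot hfin
    refine ⟨i, hi, ?_⟩
    have hpre : run (i * T) (y.take (i * L)) = run (i * T) y := run_take step C s₀ run hrun0 hrunS (i * T) (i * L) (by rw [hL, Nat.mul_assoc]) y
    refine ⟨by rw [hpre]; exact hnt, fun t ht => ?_⟩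
    rw [hpre, hL, chunk_of_block y C T i t ht]
    exact hsteps t ht
  have hblk : ∀ i < N, ∀ w : List Bool, w.length = i * L → uniformProb L (B i w) ≤ θ ^ T := by
    intro i _ w _
    by_cases ht : term (run (i * T) w) = false
    · have hset : B i w = {blk | ∀ t < T, (fun c => step (run (i * T) w) c = run (i * T) w) (PCPVerifier.block C t blk)} := by
        ext blk
        simp only [hB, Set.mem_setOf_eq, ht, true_and, PCPVerifier.block]
      rw [hset, hL, PCPVerifier.uniformProb_blocks C (fun c => step (run (i * T) w) c = run (i * T) w) T]
      exact pow_le_pow_left₀ (uniformProb_nonneg _ _)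
        (hprob _ (inv_run step pot Inv C s₀ run hrun0 hrunS h0 hstep _ w).1 ht) T
    · have hset : B i w = ∅ := Set.eq_empty_of_forall_notMem fun blk hblk => ht hblk.1
      rw [hset, uniformProb_empty]
      positivity
  calc uniformProb (N * L) {y | term (run (N * T) y) = false}
      ≤ uniformProb (N * L) {y | ∃ i < N, (y.drop (i * L)).take L ∈ B i (y.take (i * L))} :=
        uniformProb_mono_of_length' fun y hy h => hsub y hy h
    _ ≤ N * θ ^ T := uniformProb_exists_badBlock_le le_rfl B fun i hi w hw => hblk i hi w hw

end Stages

/-- **A chunk inside the prefix is a chunk of the prefix** (registered brick `grow_chunkOfTake` of stub `stub_growFinder`, line `dual-pingpong-frame`, crux stmt-QuantumAdvantage-13932). [folklore] -/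
theorem grow_chunkOfTake : ∀ (y : List Bool) (C K t : ℕ), t * C + C ≤ K → (((y.take K).drop (t * C)).take C) = (y.drop (t * C)).take C :=
  fun y C K t h => chunk_of_take y C K t h

end Summit.QuantumAdvantage.QuantumAdvantage.Theorems.SignedExactCubicForrelationNotPrBPP.GrowMachine
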